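import Mathlib.LinearAlgebra.Matrix.Kronecker
import Mathlib.Analysis.SpecificLimits.Basic
import Literature.MathematicalPhysics.QuantumLattice.SpinChainsAkltGroundStateProofs
import Literature.MathematicalPhysics.QuantumLattice.SpinChainsAkltUniqueProofs
import Literature.MathematicalPhysics.QuantumLattice.HeisenbergModelProofs
import HarnessLib

/-!
# AKLT ring: transfer-matrix evaluation of the valence-bond two-point function

Trunk **T-QLATTICE**. Sibling proof file of
`Literature/MathematicalPhysics/QuantumLattice/SpinChains.lean` (theorem-only: no statement or
definition of the tree is introduced or changed; no named fact is introduced). It serves the named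
fact `Literature.MathematicalPhysics.QuantumLattice.aklt_correlation_decay` (AKLT, exponential
decay of the ground-state correlations of the AKLT ring, `⟨𝐒_0 · 𝐒_x⟩_L → 4(-1/3)^x`):

* the finite-volume content is proved outright —
  `akltVBS_norm_sq`: `⟨Ω_L, Ω_L⟩ = 1 + 3(-1/3)^L` and
  `akltVBS_spinDot`: `⟨Ω_L, 𝐒_0 · 𝐒_{a+1} Ω_L⟩ = -(4/3)((-1/3)ᵃ + (-1/3)ᵇ)` on the ring of
  `L = a + 1 + (b + 1)` sites, for the valence-bond (matrix product) state `Ω_L = akltVBS L`;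
* the discharge of `aklt_correlation_decay` is reduced to the uniqueness of the periodic ground
  state: `aklt_correlation_decay_of_unique : aklt_unique_periodic → aklt_correlation_decay`
  (the ground-state property `aklt_isGroundStateVector_akltVBS_holds` is already in the tree,
  `SpinChainsAkltGroundStateProofs.lean`; `aklt_unique_periodic` is a named fact of
  `SpinChains.lean`, discharged in the sibling file `SpinChainsAkltUniqueProofs.lean`), and
  `aklt_correlation_decay_holds := aklt_correlation_decay_of_unique aklt_unique_periodic_holds`
  discharges the fact.

## Source

I. Affleck, T. Kennedy, E. H. Lieb, H. Tasaki, *Valence bond ground states in isotropic quantum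
antiferromagnets*, Comm. Math. Phys. **115** (1988) 477–528 (held: `paper:doi-10-1007-bf01218021`),
§2.2 "The Ground State Two-Point Correlation Function", p. 485: "We will use periodic boundary
conditions. We will show that `ω(S^a_0 S^b_r) = δ_{ab} (-1)^r (4/3) 3^{-r}` (2.13), where
`ω(S^a_0 S^b_r)` denotes the limit as `L → ∞` of the expectation of `S^a_0 S^b_r` in the ground
state of the chain with `L` sites and periodic boundary conditions"; pp. 485–487: the norm
((2.14a/b), "The normalization of the ground state with periodic boundary conditions can be found
by taking traces in (2.14) or by summing graphs on a circle") and the two-point function are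
computed by summing transfer ("loop") diagrams around the ring, "for `L → ∞` with `r` fixed they
must take the shorter path to contribute". Summing (2.13) over `a = b` gives
`⟨𝐒_0 · 𝐒_r⟩ → 4 (-1/3)^r`, the statement of `aklt_correlation_decay`. H. Tasaki, *Physics and
Mathematics of Quantum Many-Body Systems* (Springer, 2020), §7.1.3 (same computation in matrix
product language); M. Fannes, B. Nachtergaele, R. F. Werner, Comm. Math. Phys. **144** (1992)
443–490, §2 and §7 (transfer operator `𝔼` of a finitely correlated state, AKLT example);
U. Schollwöck, Ann. Phys. **326** (2011) 96, §4.1.5 (the AKLT tensor gauge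
`A⁺ = √(2/3) σ⁺, A⁰ = -√(1/3) σᶻ, A⁻ = -√(2/3) σ⁻` used by `akltTensor`).

## Proof (matrix-product / transfer-matrix form of AKLT §2.2)

1. *Transfer-matrix bookkeeping* (any MPS tensors `B`, `A`): `tr(B^τ) tr(A^{τ'}) =
   tr ∏ᵢ (B^{τᵢ} ⊗ A^{τ'ᵢ})` (`Matrix.trace_kronecker`, mixed-product property
   `kronecker_prod_ofFn`), and a sum over words of an ordered product is the ordered product of the
   sums (`prod_ofFn_sum`). Hence `Σ_τ tr(B^τ) tr(A^τ) = tr 𝔼^L` with `𝔼 = Σ_k B^k ⊗ A^k`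
   (`sum_trace_mul_trace`), and with single-site matrices `c₀, c₁` inserted at the sites `0` and
   `a + 1` of `L = a + 1 + (b + 1)` sites,
   `⟨ψ, (c₀)₀(c₁)_{a+1} ψ⟩ = tr(𝔼_{c₀} 𝔼ᵃ 𝔼_{c₁} 𝔼ᵇ)`, `𝔼_c = Σ_{kk'} c_{kk'} Ā^k ⊗ A^{k'}`
   (`mpsPeriodic_twoPoint`; the entries of `(c₀)₀(c₁)_{x}` are `onSite_mul_onSite_apply_of_ne`).
2. *AKLT algebra.* The AKLT tensor is real (`akltTensor_map_conj`). Its transfer matrix is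
   `𝔼 = -⅓·1 + ⅔ v vᵀ` with `v = vec(𝟙₂)`, `v·v = 2` (`akltTransfer_eq`; eigenvalue `1` on `v`,
   `-1/3` on `v^⊥`), so `𝔼ⁿ = (-⅓)ⁿ·1 + ½(1 - (-⅓)ⁿ) v vᵀ` (`pow_eq_of_rankOne`) and
   `tr 𝔼^L = 1 + 3(-1/3)^L`. For each spin component the insertion `𝔼_{S^α}` satisfies
   `vᵀ𝔼_{S^α}v = 0`, `vᵀ𝔼_{S^α}²v = -8/9`, `tr 𝔼_{S^α}² = -8/9` (`akltInsert_dot`,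
   `akltInsert_dot_sq`, `trace_akltInsert_sq`: `16`-entry computations, polynomial identities in
   `s² = 2/3`, `t² = 1/3`, `(√2)² = 2`), whence `tr(𝔼_{S^α} 𝔼ᵃ 𝔼_{S^α} 𝔼ᵇ) = -(4/9)((-⅓)ᵃ + (-⅓)ᵇ)`
   (`trace_twoPoint_of_rankOne`) and, summing over `α`, `-(4/3)((-⅓)ᵃ + (-⅓)ᵇ)`.
3. *Ring.* `akltVBS L σ = tr(A^{σ ∘ finEquiv})` is the MPS on `Fin L` read through the labelling
   `ZMod.finEquiv L`; quadratic forms are transported by `reindexOp` (`star_dotProduct_mulVec_comp`,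
   `reindexOp_spinDot`), giving `akltVBS_norm_sq` and `akltVBS_spinDot`.
4. *Ground state.* For a non-degenerate ground state `Ω` the tracial ground-state functional is the
   vector state `O ↦ ⟨Ω, OΩ⟩/⟨Ω, Ω⟩` (`groundStateFunctional_eq_of_hasUniqueGroundState`: the
   ground projection is `|Ω⟩⟨Ω|/⟨Ω,Ω⟩`, Mathlib `Submodule.starProjection_singleton`). With
   `aklt_isGroundStateVector_akltVBS_holds` and uniqueness (`3 ≤ L`) this gives the finite-volume
   correlation `akltRingCorr (a+1+(b+1)) (a+1) = -(4/3)((-⅓)ᵃ + (-⅓)ᵇ)/(1 + 3(-⅓)^L)`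
   (`akltRingCorr_eq_of_unique`), whose limit along `b → ∞` is `-(4/3)(-⅓)ᵃ = 4(-⅓)^{a+1}`
   (`aklt_correlation_decay_of_unique`, via `tendsto_add_atTop_iff_nat`).

## References

* I. Affleck, T. Kennedy, E. H. Lieb, H. Tasaki, Comm. Math. Phys. **115** (1988) 477–528,
  doi:10.1007/bf01218021, §2.2, eq. (2.13) p. 485, eqs. (2.14a/b) p. 486. [AffleckEtAl1988]
  (= [AKLT1988])
* H. Tasaki, *Physics and Mathematics of Quantum Many-Body Systems*, Springer GTP (2020), §7.1.3.
  [Tasaki2020]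
* M. Fannes, B. Nachtergaele, R. F. Werner, Comm. Math. Phys. **144** (1992) 443–490,
  doi:10.1007/bf02099178, §2, §7. [FannesNachtergaeleWernerCMP1992]
* U. Schollwöck, Ann. Phys. **326** (2011) 96–192, §4.1.5. [Schollwock2011]
-/

noncomputable section

open Matrix Complex Finset Filter
open scoped Kronecker Topology ComplexOrder

namespace Literature.MathematicalPhysics.QuantumLattice

section Infra

variable {m R : Type*} [Fintype m] [DecidableEq m]

/-- Kronecker product of two ordered products of equal length is the ordered product of the
Kronecker products (mixed-product property, iterated). [folklore] -/
theorem kronecker_prod_ofFn [CommRing R] {n : ℕ} (f g : Fin n → Matrix m m R) :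
    (List.ofFn f).prod ⊗ₖ (List.ofFn g).prod = (List.ofFn fun i => f i ⊗ₖ g i).prod := by
  induction n with
  | zero => simp
  | succ n ih =>
    rw [List.ofFn_succ, List.ofFn_succ, List.ofFn_succ, List.prod_cons, List.prod_cons,
      List.prod_cons, ← ih, Matrix.mul_kronecker_mul]

/-- Sum over words of ordered products = ordered product of the sums (distributivity in a
non-commutative semiring): `∏ᵢ (Σ_b F i b) = Σ_{g : Fin n → β} ∏ᵢ F i (g i)`. [folklore] -/
theorem prod_ofFn_sum {β : Type*} [Fintype β] [Semiring R] {n : ℕ} (F : Fin n → β → R) :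
    (List.ofFn fun i => ∑ b, F i b).prod =
      ∑ g : Fin n → β, (List.ofFn fun i => F i (g i)).prod := by
  induction n with
  | zero => simp
  | succ n ih =>
    rw [List.ofFn_succ, List.prod_cons, ih, Finset.sum_mul_sum,
      ← (Fin.consEquiv fun _ => β).sum_comp, Fintype.sum_prod_type]
    refine Finset.sum_congr rfl fun b _ => Finset.sum_congr rfl fun g _ => ?_
    rw [List.ofFn_succ, List.prod_cons]
    simp [Fin.consEquiv]

/-- Scalars pull out of an ordered product: `∏ᵢ (cᵢ • Mᵢ) = (∏ᵢ cᵢ) • ∏ᵢ Mᵢ`. [folklore] -/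
theorem prod_ofFn_smul [CommRing R] {n : ℕ} (c : Fin n → R) (M : Fin n → Matrix m m R) :
    (List.ofFn fun i => c i • M i).prod = (∏ i, c i) • (List.ofFn M).prod := by
  induction n with
  | zero => simp
  | succ n ih =>
    rw [List.ofFn_succ, List.prod_cons, ih, List.ofFn_succ, List.prod_cons, Fin.prod_univ_succ,
      smul_mul_assoc, mul_smul_comm, smul_smul]

/-- An ordered product over `Fin (a + 1 + (b + 1))` whose factors are `E₀` at position `0`,
`E₁` at position `a + 1` and `T` elsewhere equals `E₀ T^a E₁ T^b`. [folklore] -/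
theorem prod_ofFn_two_marked [Semiring R] (E₀ E₁ T : R) (a b : ℕ)
    (f : Fin (a + 1 + (b + 1)) → R)
    (hf : ∀ i, f i = if (i : ℕ) = 0 then E₀ else if (i : ℕ) = a + 1 then E₁ else T) :
    (List.ofFn f).prod = E₀ * T ^ a * (E₁ * T ^ b) := by
  have hT : ∀ i : Fin (a + 1 + (b + 1)), (i : ℕ) ≠ 0 → (i : ℕ) ≠ a + 1 → f i = T :=
    fun i h0 h1 => by rw [hf, if_neg h0, if_neg h1]
  have hrep : ∀ (k : ℕ) (g : Fin k → Fin (a + 1 + (b + 1))),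
      (∀ i, ((g i : Fin _) : ℕ) ≠ 0 ∧ ((g i : Fin _) : ℕ) ≠ a + 1) →
      (List.ofFn fun i => f (g i)) = List.replicate k T := by
    intro k g hg
    rw [← List.ofFn_const]
    exact congrArg List.ofFn (funext fun i => hT _ (hg i).1 (hg i).2)
  have h0 : f (Fin.castLE (Nat.le_add_right (a + 1) (b + 1)) 0) = E₀ := by
    rw [hf]; simp
  have h1 : f (Fin.natAdd (a + 1) 0) = E₁ := by
    rw [hf]; simp
  rw [List.ofFn_add, List.prod_append, List.ofFn_succ, List.prod_cons, List.ofFn_succ,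
    List.prod_cons, h0, h1,
    hrep a _ (fun i => by have := i.isLt; simp only [Fin.val_castLE, Fin.val_succ]; omega),
    hrep b _ (fun i => by have := i.isLt; simp only [Fin.val_natAdd, Fin.val_succ]; omega),
    List.prod_replicate, List.prod_replicate, mul_assoc]

variable {Λ : Type*} [Fintype Λ] [DecidableEq Λ] {q : ℕ}

/-- Entries of the product of two single-site operators at distinct sites:
`⟨σ| (a ⊗ 𝟙)(𝟙 ⊗ b) |τ⟩ = a_{σ_x τ_x} b_{σ_y τ_y}` if `σ = τ` off `{x, y}`, else `0`.
Tasaki (2020) §2.2, eq. (2.2.5). [folklore] -/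
theorem onSite_mul_onSite_apply_of_ne {x y : Λ} (hxy : x ≠ y) (a b : Matrix (Fin q) (Fin q) ℂ)
    (σ τ : TensorIndex Λ q) :
    (onSite x a * onSite y b : Op Λ q) σ τ =
      if (∀ z, z ≠ x → z ≠ y → σ z = τ z) then a (σ x) (τ x) * b (σ y) (τ y) else 0 := by
  rw [Matrix.mul_apply, Finset.sum_eq_single (Function.update σ x (τ x))]
  · rw [onSite_apply, onSite_apply, if_pos fun z hz => (Function.update_of_ne hz _ _).symm,
      Function.update_self, Function.update_of_ne hxy.symm]
    have hc : (∀ z, z ≠ y → Function.update σ x (τ x) z = τ z) ↔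
        ∀ z, z ≠ x → z ≠ y → σ z = τ z := by
      constructor
      · intro h z hzx hzy
        rw [← h z hzy, Function.update_of_ne hzx]
      · intro h z hzy
        by_cases hzx : z = x
        · subst hzx; rw [Function.update_self]
        · rw [Function.update_of_ne hzx]; exact h z hzx hzy
    rw [if_congr hc rfl rfl]
    split_ifs <;> simp
  · intro ρ _ hρ
    rw [onSite_apply, onSite_apply]
    split_ifs with h1 h2
    · exfalso
      apply hρ
      funext z
      by_cases hzx : z = x
      · subst hzx
        rw [Function.update_self]
        exact h2 z hxy
      · rw [Function.update_of_ne hzx]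
        exact (h1 z hzx).symm
    · exact mul_zero _
    · exact zero_mul _
    · exact zero_mul _
  · exact fun h => absurd (Finset.mem_univ _) h

end Infra

/-! ### The tracial ground-state functional of a non-degenerate ground state -/

section UniqueGroundState

variable {n : Type*} [Fintype n] [DecidableEq n]

/-- **Ground-state expectation for a unique ground state.** If `A` has a one-dimensional ground
space containing the nonzero vector `Ω`, the tracial ground-state functional is the vector state
`O ↦ ⟨Ω, O Ω⟩ / ⟨Ω, Ω⟩`: the ground-state projection is the rank-one projection
`|Ω⟩⟨Ω| / ⟨Ω, Ω⟩` (Mathlib `Submodule.starProjection_singleton`). Tasaki (2020) §2.1;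
Bratteli–Robinson II §5.3.1. [folklore] -/
theorem groundStateFunctional_eq_of_hasUniqueGroundState {A : Matrix n n ℂ}
    (hA : A.HasUniqueGroundState) {Ω : n → ℂ} (hΩ : Ω ∈ A.groundSpace) (hΩ0 : Ω ≠ 0)
    (O : Matrix n n ℂ) :
    A.groundStateFunctional O = (star Ω ⬝ᵥ O *ᵥ Ω) / (star Ω ⬝ᵥ Ω) := by
  -- the ground space is the line spanned by `Ω`
  have hspan : A.groundSpace = ℂ ∙ Ω :=
    eq_span_singleton_of_mem_of_finrank_eq_one hA hΩ hΩ0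
  have hK : A.groundSpace.map
      ((WithLp.linearEquiv 2 ℂ (n → ℂ)).symm : (n → ℂ) →ₗ[ℂ] EuclideanSpace ℂ n) =
        ℂ ∙ (WithLp.toLp 2 Ω) := by
    rw [hspan, Submodule.map_span, Set.image_singleton]
    rfl
  -- `⟨Ω, Ω⟩ = ‖Ω‖²` (in the `RCLike` coercion used by `starProjection_singleton`)
  have hN := inner_self_eq_norm_sq_to_K (𝕜 := ℂ) (WithLp.toLp 2 Ω : EuclideanSpace ℂ n)
  rw [EuclideanSpace.inner_toLp_toLp, dotProduct_comm, ← RCLike.ofReal_pow] at hN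
  have hN0 : star Ω ⬝ᵥ Ω ≠ 0 := by
    rw [hN, Ne, RCLike.ofReal_eq_zero]
    have : ‖(WithLp.toLp 2 Ω : EuclideanSpace ℂ n)‖ ≠ 0 := by
      rw [norm_ne_zero_iff]
      intro h
      exact hΩ0 (by simpa using congrArg WithLp.ofLp h)
    exact pow_ne_zero 2 this
  -- the ground-state projection is `|Ω⟩⟨Ω| / ⟨Ω, Ω⟩`
  have hP : A.groundProj = (star Ω ⬝ᵥ Ω)⁻¹ • vecMulVec Ω (star Ω) := by
    rw [ext_iff_mulVec]
    intro w
    have h := projMatrix_mulVec (A.groundSpace.map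
      ((WithLp.linearEquiv 2 ℂ (n → ℂ)).symm : (n → ℂ) →ₗ[ℂ] EuclideanSpace ℂ n)) (WithLp.toLp 2 w)
    rw [← groundProj_eq] at h
    change A.groundProj *ᵥ w = _ at h
    rw [h, hK, Submodule.starProjection_singleton, ← hN, EuclideanSpace.inner_toLp_toLp,
      dotProduct_comm w, WithLp.ofLp_smul, WithLp.ofLp_toLp, smul_mulVec, vecMulVec_mulVec,
      op_smul_eq_smul, smul_smul, div_eq_inv_mul]
  rw [groundStateFunctional_apply, hP, trace_smul, trace_vecMulVec, Matrix.smul_mul, trace_smul,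
    trace_mul_comm, mul_vecMulVec, trace_vecMulVec, smul_eq_mul, smul_eq_mul,
    dotProduct_comm Ω (star Ω), dotProduct_comm (O *ᵥ Ω) (star Ω), inv_mul_cancel₀ hN0, inv_one,
    one_mul, div_eq_inv_mul]

end UniqueGroundState

/-! ### Transfer-matrix formulas for matrix product states -/

section Transfer

variable {q D : ℕ}

/-- Complex conjugation of a periodic MPS amplitude conjugates the tensor:
`conj tr (A^{τ₀} ⋯ A^{τ_{L-1}}) = tr (Ā^{τ₀} ⋯ Ā^{τ_{L-1}})`. [folklore] -/
theorem star_mpsPeriodic_apply (L : ℕ) (A : MPSTensor q D) (τ : TensorIndex (Fin L) q) :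
    star (mpsPeriodic L A τ) = mpsPeriodic L (fun k => (A k).map (starRingEnd ℂ)) τ := by
  rw [mpsPeriodic_apply, mpsPeriodic_apply, Complex.star_def, wordProduct, wordProduct,
    AddMonoidHom.map_trace, ← RingHom.mapMatrix_apply, map_list_prod, List.map_ofFn]
  rfl

/-- **Transfer-matrix formula (general form).** For two MPS tensors `B` (bra side) and `A`
(ket side) on `L` sites and site-dependent coefficient matrices `C i ∈ M_q(ℂ)`,
`Σ_{τ,τ'} (∏ᵢ C i (τ i) (τ' i)) · tr(B^{τ}) · tr(A^{τ'}) = tr ∏ᵢ 𝔼_{C i}` with the generalised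
transfer matrices `𝔼_C = Σ_{k,k'} C_{kk'} B^k ⊗ A^{k'}` (ordered product along the chain).
This is the standard "transfer operator" bookkeeping of Fannes–Nachtergaele–Werner (1992) §2 /
AKLT (1988) §2.2, written with Kronecker products. [folklore] -/
theorem sum_sum_prod_mul_trace_mul_trace (L : ℕ) (B A : MPSTensor q D)
    (C : Fin L → Matrix (Fin q) (Fin q) ℂ) :
    ∑ τ : TensorIndex (Fin L) q, ∑ τ' : TensorIndex (Fin L) q,
      (∏ i, C i (τ i) (τ' i)) * ((wordProduct B τ).trace * (wordProduct A τ').trace) =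
    (List.ofFn fun i => ∑ p : Fin q × Fin q, C i p.1 p.2 • (B p.1 ⊗ₖ A p.2)).prod.trace := by
  have h1 : ∀ τ τ' : TensorIndex (Fin L) q,
      (∏ i, C i (τ i) (τ' i)) * ((wordProduct B τ).trace * (wordProduct A τ').trace) =
        (List.ofFn fun i => C i (τ i) (τ' i) • (B (τ i) ⊗ₖ A (τ' i))).prod.trace := by
    intro τ τ'
    rw [← trace_kronecker, wordProduct, wordProduct, kronecker_prod_ofFn, prod_ofFn_smul,
      trace_smul, smul_eq_mul]
  simp_rw [h1]
  rw [← Finset.sum_product', Finset.univ_product_univ, ← trace_sum,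
    ← (Equiv.arrowProdEquivProdArrow (Fin L) (fun _ => Fin q) (fun _ => Fin q)).sum_comp,
    prod_ofFn_sum]
  rfl

/-- The transfer-matrix formula for the **overlap/norm** of periodic MPS:
`Σ_τ tr(B^τ) tr(A^τ) = tr 𝔼^L`, `𝔼 = Σ_k B^k ⊗ A^k`. Fannes–Nachtergaele–Werner (1992) §2;
AKLT (1988) §2.2 (eq. (2.14) for the AKLT chain). [folklore] -/
theorem sum_trace_mul_trace (L : ℕ) (B A : MPSTensor q D) :
    ∑ τ : TensorIndex (Fin L) q, (wordProduct B τ).trace * (wordProduct A τ).trace =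
      ((∑ k : Fin q, B k ⊗ₖ A k) ^ L).trace := by
  have h1 : ∀ τ : TensorIndex (Fin L) q,
      (wordProduct B τ).trace * (wordProduct A τ).trace =
        (List.ofFn fun i => B (τ i) ⊗ₖ A (τ i)).prod.trace := by
    intro τ
    rw [← trace_kronecker, wordProduct, wordProduct, kronecker_prod_ofFn]
  simp_rw [h1]
  rw [← trace_sum, ← prod_ofFn_sum (fun (_ : Fin L) (k : Fin q) => B k ⊗ₖ A k), List.ofFn_const,
    List.prod_replicate]

/-- Product form of the "`σ = τ` off two marked sites" constraint with two coefficient matrices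
placed at the marked sites `i₀ ≠ i₁`. [folklore] -/
theorem prod_update_update_apply {ι : Type*} [Fintype ι] [DecidableEq ι] {i₀ i₁ : ι}
    (h01 : i₀ ≠ i₁) (c₀ c₁ : Matrix (Fin q) (Fin q) ℂ) (τ τ' : ι → Fin q) :
    (∏ i, (Function.update (Function.update (fun _ => (1 : Matrix (Fin q) (Fin q) ℂ)) i₁ c₁)
      i₀ c₀) i (τ i) (τ' i)) =
      if (∀ z, z ≠ i₀ → z ≠ i₁ → τ z = τ' z) then c₀ (τ i₀) (τ' i₀) * c₁ (τ i₁) (τ' i₁)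
      else 0 := by
  rw [← Finset.mul_prod_erase _ _ (Finset.mem_univ i₀),
    ← Finset.mul_prod_erase _ _ (Finset.mem_erase.2 ⟨h01.symm, Finset.mem_univ i₁⟩),
    Function.update_self, Function.update_of_ne h01.symm, Function.update_self]
  have h3 : ∏ i ∈ (Finset.univ.erase i₀).erase i₁,
      (Function.update (Function.update (fun _ => (1 : Matrix (Fin q) (Fin q) ℂ)) i₁ c₁) i₀ c₀)
        i (τ i) (τ' i) = if (∀ z, z ≠ i₀ → z ≠ i₁ → τ z = τ' z) then 1 else 0 := by
    rw [Finset.prod_congr rfl (g := fun i => if τ i = τ' i then (1 : ℂ) else 0),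
      Finset.prod_boole]
    · by_cases hc : ∀ z, z ≠ i₀ → z ≠ i₁ → τ z = τ' z
      · rw [if_pos hc, if_pos]
        intro z hz
        obtain ⟨hz1, hz'⟩ := Finset.mem_erase.1 hz
        exact hc z (Finset.mem_erase.1 hz').1 hz1
      · rw [if_neg hc, if_neg]
        exact fun h => hc fun z hz0 hz1 =>
          h z (Finset.mem_erase.2 ⟨hz1, Finset.mem_erase.2 ⟨hz0, Finset.mem_univ z⟩⟩)
    · intro i hi
      obtain ⟨hi1, hi⟩ := Finset.mem_erase.1 hi
      obtain ⟨hi0, -⟩ := Finset.mem_erase.1 hi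
      rw [Function.update_of_ne hi0, Function.update_of_ne hi1]
      exact Matrix.one_apply
  rw [h3]
  split_ifs <;> simp

/-- **Two-point transfer-matrix formula.** For a periodic MPS `ψ = tr(A^{τ₀} ⋯ A^{τ_{L-1}})`
on `L = a + 1 + (b + 1)` sites and single-site matrices `c₀, c₁` placed at the sites `0` and
`x₁ = a + 1`, `⟨ψ, (c₀)₀ (c₁)_{x₁} ψ⟩ = tr (𝔼_{c₀} 𝔼^a 𝔼_{c₁} 𝔼^b)` with `𝔼 = Σ_k Ā^k ⊗ A^k`
and `𝔼_c = Σ_{k,k'} c_{kk'} Ā^k ⊗ A^{k'}`. AKLT (1988) §2.2; Fannes–Nachtergaele–Werner (1992)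
§2. [folklore] -/
theorem mpsPeriodic_twoPoint (a b : ℕ) (A : MPSTensor q D) (c₀ c₁ : Matrix (Fin q) (Fin q) ℂ)
    (x₁ : Fin (a + 1 + (b + 1))) (hx₁ : (x₁ : ℕ) = a + 1) :
    star (mpsPeriodic (a + 1 + (b + 1)) A) ⬝ᵥ
        ((onSite 0 c₀ * onSite x₁ c₁ : Op (Fin (a + 1 + (b + 1))) q) *ᵥ
          mpsPeriodic (a + 1 + (b + 1)) A) =
      ((∑ p : Fin q × Fin q, c₀ p.1 p.2 • ((A p.1).map (starRingEnd ℂ) ⊗ₖ A p.2)) *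
          (∑ k : Fin q, (A k).map (starRingEnd ℂ) ⊗ₖ A k) ^ a *
        ((∑ p : Fin q × Fin q, c₁ p.1 p.2 • ((A p.1).map (starRingEnd ℂ) ⊗ₖ A p.2)) *
          (∑ k : Fin q, (A k).map (starRingEnd ℂ) ⊗ₖ A k) ^ b)).trace := by
  have hx : (0 : Fin (a + 1 + (b + 1))) ≠ x₁ := fun h => by
    have h' := congrArg Fin.val h
    rw [hx₁] at h'
    exact Nat.succ_ne_zero a h'.symm
  -- expand the quadratic form
  have hq : star (mpsPeriodic (a + 1 + (b + 1)) A) ⬝ᵥ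
      ((onSite 0 c₀ * onSite x₁ c₁ : Op (Fin (a + 1 + (b + 1))) q) *ᵥ
        mpsPeriodic (a + 1 + (b + 1)) A) =
      ∑ τ : TensorIndex (Fin (a + 1 + (b + 1))) q, ∑ τ' : TensorIndex (Fin (a + 1 + (b + 1))) q,
        (∏ i, (Function.update (Function.update (fun _ => (1 : Matrix (Fin q) (Fin q) ℂ)) x₁ c₁)
          0 c₀) i (τ i) (τ' i)) *
          ((wordProduct (fun k => (A k).map (starRingEnd ℂ)) τ).trace *
            (wordProduct A τ').trace) := by
    simp only [dotProduct, mulVec, Finset.mul_sum, Pi.star_apply, star_mpsPeriodic_apply]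
    refine Finset.sum_congr rfl fun τ _ => Finset.sum_congr rfl fun τ' _ => ?_
    rw [prod_update_update_apply hx, onSite_mul_onSite_apply_of_ne hx, mpsPeriodic_apply,
      mpsPeriodic_apply]
    split_ifs <;> ring
  rw [hq, sum_sum_prod_mul_trace_mul_trace (a + 1 + (b + 1)) (fun k => (A k).map (starRingEnd ℂ))
    A (Function.update (Function.update (fun _ => (1 : Matrix (Fin q) (Fin q) ℂ)) x₁ c₁) 0 c₀)]
  refine congrArg Matrix.trace (prod_ofFn_two_marked _ _ _ a b _ fun i => ?_)
  have hval0 : ((0 : Fin (a + 1 + (b + 1))) : ℕ) = 0 := rfl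
  by_cases h0 : i = 0
  · rw [h0, Function.update_self, if_pos hval0]
  by_cases h1 : i = x₁
  · have hne : (x₁ : ℕ) ≠ 0 := by rw [hx₁]; exact Nat.succ_ne_zero a
    rw [h1, Function.update_of_ne hx.symm, Function.update_self, if_neg hne, if_pos hx₁]
  · have h0' : (i : ℕ) ≠ 0 := fun h => h0 (Fin.ext (h.trans hval0.symm))
    have h1' : (i : ℕ) ≠ a + 1 := fun h => h1 (Fin.ext (h.trans hx₁.symm))
    rw [Function.update_of_ne h0, Function.update_of_ne h1, if_neg h0', if_neg h1',
      Fintype.sum_prod_type]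
    refine Finset.sum_congr rfl fun k _ => ?_
    rw [Finset.sum_eq_single k]
    · rw [Matrix.one_apply_eq, one_smul]
    · intro k' _ hk'
      rw [Matrix.one_apply_ne' hk', zero_smul]
    · exact fun h => absurd (Finset.mem_univ _) h

/-- **Norm of a periodic MPS**: `⟨ψ, ψ⟩ = tr 𝔼^L`, `𝔼 = Σ_k Ā^k ⊗ A^k`.
Fannes–Nachtergaele–Werner (1992) §2; AKLT (1988) eq. (2.14). [folklore] -/
theorem mpsPeriodic_norm_sq (L : ℕ) (A : MPSTensor q D) :
    star (mpsPeriodic L A) ⬝ᵥ mpsPeriodic L A =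
      ((∑ k : Fin q, (A k).map (starRingEnd ℂ) ⊗ₖ A k) ^ L).trace := by
  rw [← sum_trace_mul_trace]
  simp only [dotProduct, Pi.star_apply, star_mpsPeriodic_apply]
  rfl

end Transfer

/-! ### Rank-one-plus-scalar transfer matrices: `T = r·1 + (1-r)/2 · v vᵀ` -/

section RankOne

variable {ι : Type*} [Fintype ι] [DecidableEq ι]

/-- Powers of `T = r·1 + ((1-r)/2)·v vᵀ` with `v·v = 2` (so that `½ v vᵀ` is a rank-one
projection commuting with `T`): `Tⁿ = rⁿ·1 + ((1-rⁿ)/2)·v vᵀ`. [folklore] -/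
theorem pow_eq_of_rankOne {T : Matrix ι ι ℂ} {v : ι → ℂ} {r : ℂ}
    (hT : T = r • (1 : Matrix ι ι ℂ) + ((1 - r) / 2) • vecMulVec v v) (hv : v ⬝ᵥ v = 2)
    (n : ℕ) :
    T ^ n = r ^ n • (1 : Matrix ι ι ℂ) + ((1 - r ^ n) / 2) • vecMulVec v v := by
  induction n with
  | zero => simp
  | succ n ih =>
    rw [pow_succ, ih, hT]
    simp only [add_mul, mul_add, smul_mul_assoc, mul_smul_comm, one_mul, mul_one,
      vecMulVec_mul_vecMulVec, hv, vecMulVec_smul, smul_smul]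
    module

/-- Trace of the powers: `tr Tⁿ = |ι| rⁿ + (1 - rⁿ)`. [folklore] -/
theorem trace_pow_of_rankOne {T : Matrix ι ι ℂ} {v : ι → ℂ} {r : ℂ}
    (hT : T = r • (1 : Matrix ι ι ℂ) + ((1 - r) / 2) • vecMulVec v v) (hv : v ⬝ᵥ v = 2)
    (n : ℕ) :
    (T ^ n).trace = (Fintype.card ι : ℂ) * r ^ n + (1 - r ^ n) := by
  rw [pow_eq_of_rankOne hT hv n, trace_add, trace_smul, trace_smul, trace_one, trace_vecMulVec,
    hv, smul_eq_mul, smul_eq_mul]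
  ring

/-- **Two-point trace identity.** For `T = r·1 + ((1-r)/2)·v vᵀ` with `v·v = 2` and an
insertion `E` with `vᵀ E v = 0`, `vᵀ E² v = -8/9`, `tr E² = -8/9` one has
`tr (E Tᵃ E Tᵇ) = -(4/9)(rᵃ + rᵇ)` for all `a, b` (the algebra behind AKLT (1988) eq. (2.13)).
[folklore] -/
theorem trace_twoPoint_of_rankOne {T E : Matrix ι ι ℂ} {v : ι → ℂ} {r : ℂ}
    (hT : T = r • (1 : Matrix ι ι ℂ) + ((1 - r) / 2) • vecMulVec v v) (hv : v ⬝ᵥ v = 2)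
    (h3 : v ⬝ᵥ (E *ᵥ v) = 0) (h4 : v ⬝ᵥ (E *ᵥ (E *ᵥ v)) = -(8 / 9))
    (h5 : (E * E).trace = -(8 / 9)) (a b : ℕ) :
    (E * T ^ a * (E * T ^ b)).trace = -(4 / 9) * (r ^ a + r ^ b) := by
  have hE : ∀ n : ℕ, E * T ^ n = r ^ n • E + ((1 - r ^ n) / 2) • vecMulVec (E *ᵥ v) v := by
    intro n
    rw [pow_eq_of_rankOne hT hv n, mul_add, mul_smul_comm, mul_one, mul_smul_comm, mul_vecMulVec]
  have h4' : (E *ᵥ (E *ᵥ v)) ⬝ᵥ v = -(8 / 9) := by rw [dotProduct_comm, h4]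
  have h4'' : (E *ᵥ v) ⬝ᵥ (v ᵥ* E) = -(8 / 9) := by
    rw [dotProduct_comm, ← dotProduct_mulVec, h4]
  rw [hE a, hE b]
  simp only [add_mul, mul_add, smul_mul_assoc, mul_smul_comm, mul_vecMulVec, trace_add,
    trace_smul, trace_vecMulVec, h5, h4', smul_eq_mul, vecMulVec_mul, h4'', vecMulVec_mulVec,
    op_smul_eq_smul, h3, zero_smul, zero_dotProduct, mul_zero, add_zero]
  ring

end RankOne

/-! ### The AKLT transfer matrices -/

section AKLTTransfer

/-- The entries of the AKLT tensor are real. Schollwöck (2011) §4.1.5, eq. (79). [folklore] -/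
theorem akltTensor_map_conj (k : Fin 3) : (akltTensor k).map (starRingEnd ℂ) = akltTensor k := by
  ext i j
  fin_cases k <;> fin_cases i <;> fin_cases j <;> simp [akltTensor, Complex.conj_ofReal]

/-- Hence the AKLT valence-bond state has real amplitudes: `conj Ω = Ω`. [folklore] -/
theorem star_mpsPeriodic_akltTensor (L : ℕ) :
    star (mpsPeriodic L akltTensor) = mpsPeriodic L akltTensor := by
  funext τ
  rw [Pi.star_apply, star_mpsPeriodic_apply]
  simp_rw [akltTensor_map_conj]

/-- The diagonal indicator vector `v = vec(𝟙₂)` on `Fin 2 × Fin 2` (the fixed point of the AKLT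
transfer matrix) has `v · v = 2`. [folklore] -/
theorem akltDiag_dotProduct :
    (fun p : Fin 2 × Fin 2 => if p.1 = p.2 then (1 : ℂ) else 0) ⬝ᵥ
      (fun p : Fin 2 × Fin 2 => if p.1 = p.2 then (1 : ℂ) else 0) = 2 := by
  simp only [dotProduct, Fintype.sum_prod_type, Fin.sum_univ_two]
  norm_num

/-- **The AKLT transfer matrix** `𝔼 = Σ_k A^k ⊗ A^k = ⅓ σᶻ⊗σᶻ + ⅔ (σ⁺⊗σ⁺ + σ⁻⊗σ⁻)` is
`-⅓·1 + ⅔ · v vᵀ` with `v = vec(𝟙₂)`: eigenvalue `1` on `v` (normalisation `𝔼(𝟙) = 𝟙`) and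
`-1/3` (three-fold) on `v^⊥`. AKLT (1988) §2.2; Fannes–Nachtergaele–Werner (1992) §7;
Schollwöck (2011) §4.1.5. [folklore] -/
theorem akltTransfer_eq :
    (∑ k : Fin 3, akltTensor k ⊗ₖ akltTensor k) =
      (-1 / 3 : ℂ) • (1 : Matrix (Fin 2 × Fin 2) (Fin 2 × Fin 2) ℂ) +
        ((1 - (-1 / 3 : ℂ)) / 2) •
          vecMulVec (fun p : Fin 2 × Fin 2 => if p.1 = p.2 then (1 : ℂ) else 0)
            (fun p : Fin 2 × Fin 2 => if p.1 = p.2 then (1 : ℂ) else 0) := by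
  obtain ⟨s, t, hs, ht, hA⟩ := akltTensor_eq_of_sq
  rw [hA]
  ext ⟨i, j⟩ ⟨k, l⟩
  fin_cases i <;> fin_cases j <;> fin_cases k <;> fin_cases l <;>
    simp [Matrix.sum_apply, Fin.sum_univ_three, Matrix.kroneckerMap_apply, vecMulVec_apply] <;>
    (try ring_nf) <;> (try simp only [hs, ht]) <;> (try norm_num)


/-- **First AKLT insertion identity**: `vᵀ 𝔼_{S^α} v = 0` for each spin component (the
one-point function `⟨S^α⟩` of the VBS state vanishes). AKLT (1988) §2.2. [folklore] -/
theorem akltInsert_dot (α : Fin 3) :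
    (fun p : Fin 2 × Fin 2 => if p.1 = p.2 then (1 : ℂ) else 0) ⬝ᵥ
      ((∑ p : Fin 3 × Fin 3, spinVec 2 α p.1 p.2 • (akltTensor p.1 ⊗ₖ akltTensor p.2)) *ᵥ
        (fun p : Fin 2 × Fin 2 => if p.1 = p.2 then (1 : ℂ) else 0)) = 0 := by
  obtain ⟨s, t, hs, ht, hA⟩ := akltTensor_eq_of_sq
  rw [hA]
  fin_cases α <;>
    simp [Fintype.sum_prod_type, Fin.sum_univ_three, Fin.sum_univ_two, mulVec, dotProduct,
      Matrix.sum_apply, Matrix.smul_apply, Matrix.kroneckerMap_apply, spinX, spinY,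
      spinRaise_two_apply, spinLower_two_apply, spinZ_two_apply]
  all_goals ring

/-- **Second AKLT insertion identity**: `vᵀ 𝔼_{S^α}² v = -8/9` for each spin component.
AKLT (1988) §2.2. [folklore] -/
theorem akltInsert_dot_sq (α : Fin 3) :
    (fun p : Fin 2 × Fin 2 => if p.1 = p.2 then (1 : ℂ) else 0) ⬝ᵥ
      ((∑ p : Fin 3 × Fin 3, spinVec 2 α p.1 p.2 • (akltTensor p.1 ⊗ₖ akltTensor p.2)) *ᵥ
        ((∑ p : Fin 3 × Fin 3, spinVec 2 α p.1 p.2 • (akltTensor p.1 ⊗ₖ akltTensor p.2)) *ᵥ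
          (fun p : Fin 2 × Fin 2 => if p.1 = p.2 then (1 : ℂ) else 0))) = -(8 / 9) := by
  obtain ⟨s, t, hs, ht, hA⟩ := akltTensor_eq_of_sq
  have hs4 : s ^ 4 = 4 / 9 := by rw [show s ^ 4 = (s ^ 2) ^ 2 by ring, hs]; norm_num
  have hu : ((Real.sqrt 2 : ℝ) : ℂ) ^ 2 = 2 := by
    rw [← Complex.ofReal_pow, Real.sq_sqrt zero_le_two]; norm_num
  rw [hA]
  fin_cases α <;>
    simp [Fintype.sum_prod_type, Fin.sum_univ_three, Fin.sum_univ_two, mulVec, dotProduct,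
      Matrix.sum_apply, Matrix.smul_apply, Matrix.kroneckerMap_apply, spinX, spinY,
      spinRaise_two_apply, spinLower_two_apply, spinZ_two_apply] <;>
    ring_nf <;> simp only [hs, ht, hs4, hu, Complex.I_sq] <;> norm_num

/-- **Third AKLT insertion identity**: `tr 𝔼_{S^α}² = -8/9` for each spin component.
AKLT (1988) §2.2. [folklore] -/
theorem trace_akltInsert_sq (α : Fin 3) :
    ((∑ p : Fin 3 × Fin 3, spinVec 2 α p.1 p.2 • (akltTensor p.1 ⊗ₖ akltTensor p.2)) *
      (∑ p : Fin 3 × Fin 3, spinVec 2 α p.1 p.2 • (akltTensor p.1 ⊗ₖ akltTensor p.2))).trace = -(8 / 9) := by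
  obtain ⟨s, t, hs, ht, hA⟩ := akltTensor_eq_of_sq
  have hs4 : s ^ 4 = 4 / 9 := by rw [show s ^ 4 = (s ^ 2) ^ 2 by ring, hs]; norm_num
  have hu : ((Real.sqrt 2 : ℝ) : ℂ) ^ 2 = 2 := by
    rw [← Complex.ofReal_pow, Real.sq_sqrt zero_le_two]; norm_num
  rw [hA]
  fin_cases α <;>
    simp [Fintype.sum_prod_type, Fin.sum_univ_three, Fin.sum_univ_two, Matrix.trace,
      Matrix.mul_apply, Matrix.smul_apply, Matrix.kroneckerMap_apply, spinX, spinY,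
      spinRaise_two_apply, spinLower_two_apply, spinZ_two_apply] <;>
    ring_nf <;> simp only [hs, ht, hs4, hu, Complex.I_sq] <;> norm_num


/-- **Norm of the AKLT valence-bond state on `L` sites** (MPS form):
`⟨Ω_L, Ω_L⟩ = tr 𝔼^L = 1 + 3 (-1/3)^L`. AKLT (1988) §2.2 (eq. (2.14) and "the normalization of
the ground state with periodic boundary conditions can be found by taking traces");
Fannes–Nachtergaele–Werner (1992) §7. [folklore] -/
theorem mpsPeriodic_akltTensor_norm_sq (L : ℕ) :
    star (mpsPeriodic L akltTensor) ⬝ᵥ mpsPeriodic L akltTensor = 1 + 3 * (-1 / 3 : ℂ) ^ L := by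
  rw [mpsPeriodic_norm_sq]
  simp_rw [akltTensor_map_conj]
  rw [trace_pow_of_rankOne akltTransfer_eq akltDiag_dotProduct, Fintype.card_prod,
    Fintype.card_fin]
  push_cast
  ring

/-- **Two-point function of the AKLT valence-bond state on the ring of `L = a + 1 + (b + 1)`
sites** (MPS form, sites `0` and `a + 1`):
`⟨Ω_L, 𝐒_0 · 𝐒_{a+1} Ω_L⟩ = Σ_α tr(𝔼_{S^α} 𝔼ᵃ 𝔼_{S^α} 𝔼ᵇ) = -(4/3)((-1/3)ᵃ + (-1/3)ᵇ)`.
Dividing by the norm `1 + 3(-1/3)^L` gives the finite-volume correlation whose `L → ∞` limit is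
AKLT (1988) eq. (2.13). [folklore] -/
theorem mpsPeriodic_akltTensor_spinDot (a b : ℕ) (x₁ : Fin (a + 1 + (b + 1)))
    (hx₁ : (x₁ : ℕ) = a + 1) :
    star (mpsPeriodic (a + 1 + (b + 1)) akltTensor) ⬝ᵥ
        (spinDot 2 (0 : Fin (a + 1 + (b + 1))) x₁ *ᵥ mpsPeriodic (a + 1 + (b + 1)) akltTensor) =
      -(4 / 3) * ((-1 / 3 : ℂ) ^ a + (-1 / 3 : ℂ) ^ b) := by
  have hx : (0 : Fin (a + 1 + (b + 1))) ≠ x₁ := fun h => by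
    have h' := congrArg Fin.val h
    rw [hx₁] at h'
    exact Nat.succ_ne_zero a h'.symm
  have hα : ∀ α : Fin 3, star (mpsPeriodic (a + 1 + (b + 1)) akltTensor) ⬝ᵥ
      ((siteSpin 2 (0 : Fin (a + 1 + (b + 1))) α * siteSpin 2 x₁ α) *ᵥ
        mpsPeriodic (a + 1 + (b + 1)) akltTensor) =
      -(4 / 9) * ((-1 / 3 : ℂ) ^ a + (-1 / 3 : ℂ) ^ b) := by
    intro α
    rw [siteSpin, siteSpin, mpsPeriodic_twoPoint a b akltTensor _ _ x₁ hx₁]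
    simp_rw [akltTensor_map_conj]
    exact trace_twoPoint_of_rankOne akltTransfer_eq akltDiag_dotProduct (akltInsert_dot α)
      (akltInsert_dot_sq α) (trace_akltInsert_sq α) a b
  -- for distinct sites the symmetrised bond operator is the plain product `S^α_0 S^α_{x₁}`
  have hbond : ∀ α : Fin 3, spinBond 2 α (0 : Fin (a + 1 + (b + 1))) x₁ =
      siteSpin 2 (0 : Fin (a + 1 + (b + 1))) α * siteSpin 2 x₁ α := fun α => by
    rw [spinBond, (siteSpin_commute_of_ne_holds 2 hx α α).eq.symm, ← two_smul ℂ, smul_smul]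
    norm_num
  rw [spinDot]
  simp_rw [hbond]
  rw [Matrix.sum_mulVec, dotProduct_sum]
  simp_rw [hα]
  rw [Fin.sum_univ_three]
  ring

end AKLTTransfer

/-! ### From the MPS on `Fin L` to the valence-bond state on the ring `ℤ/L` -/

section Ring

variable {Λ Λ' : Type*} [Fintype Λ] [DecidableEq Λ] [Fintype Λ'] [DecidableEq Λ'] {q : ℕ}

/-- Quadratic forms are invariant under relabelling the sites: for a bijection `g : Λ' → Λ`
and `ψ(σ) = ψ'(σ ∘ g)`, `⟨ψ, M ψ⟩ = ⟨ψ', (reindexOp e M) ψ'⟩` with `e = g⁻¹`.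
Bratteli–Robinson II §6.2.1 (covariance). [folklore] -/
theorem star_dotProduct_mulVec_comp {g : Λ' → Λ} (hg : Function.Bijective g) (M : Op Λ q)
    (ψ' : TensorIndex Λ' q → ℂ) :
    star (fun σ : TensorIndex Λ q => ψ' (σ ∘ g)) ⬝ᵥ (M *ᵥ fun σ => ψ' (σ ∘ g)) =
      star ψ' ⬝ᵥ (reindexOp (Equiv.ofBijective g hg).symm M *ᵥ ψ') := by
  set e := Equiv.ofBijective g hg with he
  have hΦ : Function.Bijective fun σ : TensorIndex Λ q => (σ ∘ g : TensorIndex Λ' q) :=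
    (Equiv.arrowCongr e.symm (Equiv.refl (Fin q))).bijective
  simp only [dotProduct, mulVec, Pi.star_apply]
  refine Fintype.sum_bijective _ hΦ _ _ fun σ => ?_
  congr 1
  refine Fintype.sum_bijective _ hΦ _ _ fun σ' => ?_
  rw [reindexOp_apply]
  congr 2
  · funext x
    exact (congrArg σ (Equiv.ofBijective_apply_symm_apply g hg x)).symm
  · funext x
    exact (congrArg σ' (Equiv.ofBijective_apply_symm_apply g hg x)).symm

/-- Quadratic forms without operator: `⟨ψ, ψ⟩ = ⟨ψ', ψ'⟩` under relabelling. [folklore] -/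
theorem star_dotProduct_comp {g : Λ' → Λ} (hg : Function.Bijective g)
    (ψ' : TensorIndex Λ' q → ℂ) :
    star (fun σ : TensorIndex Λ q => ψ' (σ ∘ g)) ⬝ᵥ (fun σ => ψ' (σ ∘ g)) = star ψ' ⬝ᵥ ψ' := by
  have h := star_dotProduct_mulVec_comp hg (1 : Op Λ q) ψ'
  rwa [one_mulVec, map_one, one_mulVec] at h

/-- `ZMod.finEquiv L` is a bijection `Fin L → ℤ/L` sending `i` to `i mod L`. [folklore] -/
theorem finEquiv_bijective (L : ℕ) [NeZero L] :
    Function.Bijective (ZMod.finEquiv L : Fin L → ZMod L) :=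
  (ZMod.finEquiv L).toEquiv.bijective

/-- **Norm of the AKLT valence-bond state on the ring `ℤ/L`**: `⟨Ω_L, Ω_L⟩ = 1 + 3(-1/3)^L`.
AKLT (1988) §2.2; Fannes–Nachtergaele–Werner (1992) §7. [folklore] -/
theorem akltVBS_norm_sq (L : ℕ) [NeZero L] :
    star (akltVBS L) ⬝ᵥ akltVBS L = 1 + 3 * (-1 / 3 : ℂ) ^ L := by
  rw [← mpsPeriodic_akltTensor_norm_sq L]
  exact star_dotProduct_comp (finEquiv_bijective L) _

/-- **Two-point function of the AKLT valence-bond state on the ring `ℤ/L`,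
`L = a + 1 + (b + 1)`**: `⟨Ω_L, 𝐒_0 · 𝐒_{a+1} Ω_L⟩ = -(4/3)((-1/3)ᵃ + (-1/3)ᵇ)`; with the
norm `1 + 3(-1/3)^L` this is the finite-volume version of AKLT (1988) eq. (2.13),
`⟨𝐒_0 · 𝐒_r⟩ → 4 (-1/3)^r`. [folklore] -/
theorem akltVBS_spinDot (a b : ℕ) :
    haveI : NeZero (a + 1 + (b + 1)) := ⟨by omega⟩
    star (akltVBS (a + 1 + (b + 1))) ⬝ᵥ
        (spinDot 2 (0 : ZMod (a + 1 + (b + 1))) ((a + 1 : ℕ) : ZMod (a + 1 + (b + 1))) *ᵥ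
          akltVBS (a + 1 + (b + 1))) =
      -(4 / 3) * ((-1 / 3 : ℂ) ^ a + (-1 / 3 : ℂ) ^ b) := by
  haveI : NeZero (a + 1 + (b + 1)) := ⟨by omega⟩
  set x₁ : Fin (a + 1 + (b + 1)) := ⟨a + 1, by omega⟩ with hx₁
  rw [← mpsPeriodic_akltTensor_spinDot a b x₁ rfl]
  refine (star_dotProduct_mulVec_comp (finEquiv_bijective _) _ _).trans ?_
  rw [reindexOp_spinDot]
  congr 3
  · rw [Equiv.symm_apply_eq, Equiv.ofBijective_apply, finEquiv_apply_eq_natCast, Fin.val_zero,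
      Nat.cast_zero]
  · rw [Equiv.symm_apply_eq, Equiv.ofBijective_apply, finEquiv_apply_eq_natCast]

end Ring

/-! ### The ground-state correlation of the AKLT ring and its `L → ∞` limit -/

section Correlation

/-- **Finite-volume AKLT correlation function** (conditional on uniqueness of the periodic
ground state). The valence-bond state `Ω_L` is a ground-state vector of the AKLT ring
(`aklt_isGroundStateVector_akltVBS_holds`); if moreover the ground state is unique for `L ≥ 3`
(`aklt_unique_periodic`), then for `L = a + 1 + (b + 1) ≥ 3` the tracial ground-state correlation
at distance `a + 1` is `⟨𝐒_0 · 𝐒_{a+1}⟩_L = -(4/3)((-1/3)ᵃ + (-1/3)ᵇ) / (1 + 3(-1/3)^L)`: the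
ground-state functional is the vector state of `Ω_L`
(`groundStateFunctional_eq_of_hasUniqueGroundState`) and numerator and denominator are
`akltVBS_spinDot`, `akltVBS_norm_sq`. AKLT (1988) §2.2, pp. 485–487 (derivation of eq. (2.13)).
[cite: AffleckEtAl1988, §2.2 pp. 485–487] -/
theorem akltRingCorr_eq_of_unique (hU : aklt_unique_periodic) (a b : ℕ) (hab : 1 ≤ a + b) :
    akltRingCorr (a + 1 + (b + 1)) (a + 1) =
      -(4 / 3) * ((-1 / 3 : ℝ) ^ a + (-1 / 3 : ℝ) ^ b) / (1 + 3 * (-1 / 3 : ℝ) ^ (a + 1 + (b + 1))) := by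
  haveI : NeZero (a + 1 + (b + 1)) := ⟨by omega⟩
  obtain ⟨h0, hΩ⟩ := aklt_isGroundStateVector_akltVBS_holds (a + 1 + (b + 1)) (by omega)
  have hmem : akltVBS (a + 1 + (b + 1)) ∈ (akltRing (a + 1 + (b + 1))).groundSpace :=
    (Matrix.mem_groundSpace_iff _ _).2 hΩ
  rw [akltRingCorr_of_neZero,
    groundStateFunctional_eq_of_hasUniqueGroundState (hU (a + 1 + (b + 1)) (by omega)) hmem h0,
    akltVBS_spinDot a b, akltVBS_norm_sq]
  have h : (-(4 / 3) * ((-1 / 3 : ℂ) ^ a + (-1 / 3 : ℂ) ^ b) /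
      (1 + 3 * (-1 / 3 : ℂ) ^ (a + 1 + (b + 1)))) =
      ((-(4 / 3) * ((-1 / 3 : ℝ) ^ a + (-1 / 3 : ℝ) ^ b) /
        (1 + 3 * (-1 / 3 : ℝ) ^ (a + 1 + (b + 1))) : ℝ) : ℂ) := by
    push_cast
    ring
  rw [h, Complex.ofReal_re]

/-- **Discharge of `aklt_correlation_decay` from uniqueness of the periodic ground state.**
Granted `aklt_unique_periodic` (uniqueness of the AKLT ring ground state for `3 ≤ L`, a named fact
of `SpinChains.lean`), the ground-state correlations of the AKLT ring converge:
`⟨𝐒_0 · 𝐒_x⟩_L → 4 (-1/3)^x` as `L → ∞` for every `x ≥ 1` — AKLT (1988) eq. (2.13),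
`ω(S^a_0 S^b_r) = δ_{ab} (-1)^r (4/3) 3^{-r}`, summed over `a = b`. Proof: along
`L = x + (m + 2)` the finite-volume formula `akltRingCorr_eq_of_unique` reads
`-(4/3)((-1/3)^{x-1} + (-1/3)^{m+1})/(1 + 3(-1/3)^L) → -(4/3)(-1/3)^{x-1} = 4(-1/3)^x`
(`tendsto_add_atTop_iff_nat`, `tendsto_pow_atTop_nhds_zero_of_abs_lt_one`).
[cite: AffleckEtAl1988, eq. (2.13) p. 485] -/
theorem aklt_correlation_decay_of_unique (hU : aklt_unique_periodic) :
    aklt_correlation_decay := by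
  intro x hx
  obtain ⟨a, rfl⟩ : ∃ a, x = a + 1 := ⟨x - 1, by omega⟩
  rw [← tendsto_add_atTop_iff_nat (a + 3)]
  have hf : (fun m : ℕ => akltRingCorr (m + (a + 3)) (a + 1)) = fun m : ℕ =>
      -(4 / 3) * ((-1 / 3 : ℝ) ^ a + (-1 / 3 : ℝ) ^ (m + 1)) /
        (1 + 3 * (-1 / 3 : ℝ) ^ (a + 1 + (m + 1 + 1))) := by
    funext m
    rw [show m + (a + 3) = a + 1 + (m + 1 + 1) by omega]
    exact akltRingCorr_eq_of_unique hU a (m + 1) (by omega)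
  rw [hf]
  have hr : Tendsto (fun m : ℕ => (-1 / 3 : ℝ) ^ m) atTop (𝓝 0) :=
    tendsto_pow_atTop_nhds_zero_of_abs_lt_one (by rw [abs_div, abs_neg, abs_one]; norm_num)
  have hr1 : Tendsto (fun m : ℕ => (-1 / 3 : ℝ) ^ (m + 1)) atTop (𝓝 0) :=
    (tendsto_add_atTop_iff_nat 1).2 hr
  have hr2 : Tendsto (fun m : ℕ => (-1 / 3 : ℝ) ^ (a + 1 + (m + 1 + 1))) atTop (𝓝 0) := by
    have h := ((tendsto_add_atTop_iff_nat (a + 3)).2 hr)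
    refine h.congr fun m => ?_
    congr 1
    omega
  have hlim : Tendsto (fun m : ℕ => -(4 / 3) * ((-1 / 3 : ℝ) ^ a + (-1 / 3 : ℝ) ^ (m + 1)) /
      (1 + 3 * (-1 / 3 : ℝ) ^ (a + 1 + (m + 1 + 1)))) atTop
      (𝓝 (-(4 / 3) * ((-1 / 3 : ℝ) ^ a + 0) / (1 + 3 * 0))) :=
    ((hr1.const_add _).const_mul _).div ((hr2.const_mul _).const_add _) (by norm_num)
  convert hlim using 2
  ring

/-- **Discharge of `aklt_correlation_decay` (AKLT, exponential decay of correlations).** The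
ground-state correlations of the AKLT ring converge, `⟨𝐒_0 · 𝐒_x⟩_L → 4 (-1/3)^x` as `L → ∞`
for every `x ≥ 1`: AKLT (1988) eq. (2.13) p. 485, `ω(S^a_0 S^b_r) = δ_{ab} (-1)^r (4/3) 3^{-r}`
("where `ω(S^a_0 S^b_r)` denotes the limit as `L → ∞` of the expectation of `S^a_0 S^b_r` in the
ground state of the chain with `L` sites and periodic boundary conditions"), summed over `a = b`.
From `aklt_correlation_decay_of_unique` (transfer-matrix evaluation of the valence-bond two-point
function, this file) and the uniqueness of the periodic ground state
`aklt_unique_periodic_holds` (`SpinChainsAkltUniqueProofs.lean`).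
[cite: AffleckEtAl1988, eq. (2.13) p. 485] -/
theorem aklt_correlation_decay_holds : aklt_correlation_decay :=
  aklt_correlation_decay_of_unique aklt_unique_periodic_holds

end Correlation

end Literature.MathematicalPhysics.QuantumLattice
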